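import Summits.QuantumFields.YangMills.Theorems.BalabanUVNodesPortS1G3COpNorm

/-!
# NODE O port PT-A — `stub_G3C` (repaired edition `G3CAtRecordL`), layer (D5): THE BLOCK SCHUR TEST in the `ℓ²`-operator norm

For a partition of the index set into blocks `b` (here: the cubes `□`, via `𝟙_□ = g3cInd`) and a kernel `R` with block operator norms `‖𝟙_{b′}·R·𝟙_b‖ ≤ B(b′, b)`, row sums
`Σ_b B(b′,b) ≤ C` and column sums `Σ_{b′} B(b′,b) ≤ C` give `‖R‖ ≤ C`.  This is how `‖R‖ < 1` is obtained VOLUME-FREE (and `Mc`-free in the far part) for the remainder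
`R = Σ_□ Σ_{Y ⊄ □̃} S_{□,Y}` of the repaired road (memo §5c): entrywise `ℓ^∞` norms would put the cube population `N_□(Mc)` into the far step and break the letter's
quantifier order (`δG` before `Mc`).  Cell `ym-nodeO-ideate`, porter hand `hand-27930-G3C` (g0); proof kind, `--supports stmt-QuantumFields-27930 --as helper`; count-neutral.

WHAT THIS FILE PROVES (sorry-free, generic, namespace `G3CCT`): `blockProj_mulVec_apply`, `sum_blockProj_mulVec`, `blockProj_idem_mulVec`, `norm_sq_eq_sum_blockProj`
(`‖w‖² = Σ_b ‖𝟙_b w‖²`), `norm_blockProj_mulVec_le` (`‖𝟙_{b′}R𝟙_b v‖ ≤ B·‖𝟙_b v‖`), `sq_sum_le_sum_mul_sum` (weighted Cauchy–Schwarz), ★ `l2_opNorm_le_of_blockSchur`.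

HONEST FRAMING.  Finite-dimensional linear algebra; nothing of Bałaban asserted, ported or discharged; `stub_G3C` NOT closed; 27930 OPEN; NODE O 0∕1; COUNT 8∕28 · K 1∕4 UNMOVED;
**the Yang–Mills mass gap is NOT proved by any of this.**  No `sorry`, no `instance`, no `notation`, no `def`; standard axioms.  [cite: Balaban1985BackgroundPropagators, (3.96) p.411]
-/

noncomputable section

open scoped BigOperators Matrix.Norms.L2Operator Matrix
open Finset WithLp Matrix

namespace Summit.QuantumFields.YangMills.Theorems.BalabanUVNodesPortS1

namespace G3CCT

variable {ι : Type*} [Fintype ι] [DecidableEq ι] {β : Type*} [Fintype β] [DecidableEq β]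

omit [Fintype β] in
/-- Entries of `𝟙_b·w`. [folklore] -/
theorem blockProj_mulVec_apply (c : ι → β) (b : β) (w : ι → ℂ) (i : ι) :
    (Matrix.diagonal (fun j => if c j = b then (1 : ℂ) else 0) *ᵥ w) i = if c i = b then w i else 0 := by
  rw [Matrix.mulVec_diagonal]; split_ifs <;> simp

/-- `Σ_b 𝟙_b·w = w`. [folklore] -/
theorem sum_blockProj_mulVec (c : ι → β) (w : ι → ℂ) :
    ∑ b, Matrix.diagonal (fun j => if c j = b then (1 : ℂ) else 0) *ᵥ w = w := by
  funext i
  rw [Finset.sum_apply]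
  simp only [blockProj_mulVec_apply]
  rw [Finset.sum_ite_eq, if_pos (Finset.mem_univ _)]

omit [Fintype β] in
/-- `𝟙_b·(𝟙_b·w) = 𝟙_b·w`. [folklore] -/
theorem blockProj_idem_mulVec (c : ι → β) (b : β) (w : ι → ℂ) :
    Matrix.diagonal (fun j => if c j = b then (1 : ℂ) else 0) *ᵥ (Matrix.diagonal (fun j => if c j = b then (1 : ℂ) else 0) *ᵥ w) =
      Matrix.diagonal (fun j => if c j = b then (1 : ℂ) else 0) *ᵥ w := by
  funext i
  simp only [blockProj_mulVec_apply]
  split_ifs <;> rfl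

/-- **Orthogonal decomposition**: `‖w‖² = Σ_b ‖𝟙_b·w‖²`. [folklore] -/
theorem norm_sq_eq_sum_blockProj (c : ι → β) (w : ι → ℂ) :
    ‖(toLp 2 w : EuclideanSpace ℂ ι)‖ ^ 2 = ∑ b, ‖(toLp 2 (Matrix.diagonal (fun j => if c j = b then (1 : ℂ) else 0) *ᵥ w) : EuclideanSpace ℂ ι)‖ ^ 2 := by
  simp only [EuclideanSpace.norm_sq_eq]
  have h : ∀ b, ∑ i, ‖(toLp 2 (Matrix.diagonal (fun j => if c j = b then (1 : ℂ) else 0) *ᵥ w) : EuclideanSpace ℂ ι) i‖ ^ 2 =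
      ∑ i, (if c i = b then ‖w i‖ ^ 2 else 0) := by
    intro b
    refine Finset.sum_congr rfl fun i _ => ?_
    rw [PiLp.toLp_apply, blockProj_mulVec_apply]
    split_ifs <;> simp
  simp only [h]
  rw [Finset.sum_comm]
  refine Finset.sum_congr rfl fun i _ => ?_
  rw [Finset.sum_ite_eq, if_pos (Finset.mem_univ _)]

omit [Fintype β] in
/-- **Block action**: `‖𝟙_{b′}·R·(𝟙_b w)‖ ≤ ‖𝟙_{b′}R𝟙_b‖·‖𝟙_b w‖`. [folklore] -/
theorem norm_blockProj_mulVec_le (c : ι → β) (R : Matrix ι ι ℂ) (b' b : β) (w : ι → ℂ) :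
    ‖(toLp 2 (Matrix.diagonal (fun j => if c j = b' then (1 : ℂ) else 0) *ᵥ (R *ᵥ (Matrix.diagonal (fun j => if c j = b then (1 : ℂ) else 0) *ᵥ w))) :
        EuclideanSpace ℂ ι)‖ ≤
      ‖Matrix.diagonal (fun j => if c j = b' then (1 : ℂ) else 0) * R * Matrix.diagonal (fun j => if c j = b then (1 : ℂ) else 0)‖ *
        ‖(toLp 2 (Matrix.diagonal (fun j => if c j = b then (1 : ℂ) else 0) *ᵥ w) : EuclideanSpace ℂ ι)‖ := by
  have e : Matrix.diagonal (fun j => if c j = b' then (1 : ℂ) else 0) *ᵥ (R *ᵥ (Matrix.diagonal (fun j => if c j = b then (1 : ℂ) else 0) *ᵥ w)) =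
      (Matrix.diagonal (fun j => if c j = b' then (1 : ℂ) else 0) * R * Matrix.diagonal (fun j => if c j = b then (1 : ℂ) else 0)) *ᵥ
        ofLp (toLp 2 (Matrix.diagonal (fun j => if c j = b then (1 : ℂ) else 0) *ᵥ w) : EuclideanSpace ℂ ι) := by
    rw [ofLp_toLp, ← blockProj_idem_mulVec c b w, Matrix.mulVec_mulVec, Matrix.mulVec_mulVec, blockProj_idem_mulVec]
  rw [e]
  exact Matrix.l2_opNorm_mulVec _ _

omit [Fintype ι] [DecidableEq ι] [DecidableEq β] in
/-- **Weighted Cauchy–Schwarz**: `(Σ_b B_b n_b)² ≤ (Σ_b B_b)·(Σ_b B_b n_b²)` for `B ≥ 0`. [folklore] -/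
theorem sq_sum_le_sum_mul_sum (B n : β → ℝ) (hB : ∀ b, 0 ≤ B b) :
    (∑ b, B b * n b) ^ 2 ≤ (∑ b, B b) * ∑ b, B b * n b ^ 2 := by
  have h := Finset.sum_mul_sq_le_sq_mul_sq Finset.univ (fun b => Real.sqrt (B b)) (fun b => Real.sqrt (B b) * n b)
  have e1 : ∀ b, Real.sqrt (B b) * (Real.sqrt (B b) * n b) = B b * n b := fun b => by
    rw [← mul_assoc, Real.mul_self_sqrt (hB b)]
  have e2 : ∀ b, Real.sqrt (B b) ^ 2 = B b := fun b => Real.sq_sqrt (hB b)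
  have e3 : ∀ b, (Real.sqrt (B b) * n b) ^ 2 = B b * n b ^ 2 := fun b => by rw [mul_pow, e2]
  simp only [e1, e2, e3] at h
  exact h

/-- ★ **THE BLOCK SCHUR TEST** (`ℓ²`-operator norm): block norms `‖𝟙_{b′}R𝟙_b‖ ≤ B(b′,b)` (`B ≥ 0`) with row sums `Σ_b B(b′,b) ≤ C` and column sums `Σ_{b′} B(b′,b) ≤ C` give `‖R‖ ≤ C`.
[cite: Balaban1985BackgroundPropagators, (3.96) p.411 (convergence of the random walk expansion)] -/
theorem l2_opNorm_le_of_blockSchur (c : ι → β) (R : Matrix ι ι ℂ) (B : β → β → ℝ) (hB : ∀ b' b, 0 ≤ B b' b)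
    (hblk : ∀ b' b, ‖Matrix.diagonal (fun j => if c j = b' then (1 : ℂ) else 0) * R * Matrix.diagonal (fun j => if c j = b then (1 : ℂ) else 0)‖ ≤ B b' b)
    {C : ℝ} (hC : 0 ≤ C) (hrow : ∀ b', ∑ b, B b' b ≤ C) (hcol : ∀ b, ∑ b', B b' b ≤ C) : ‖R‖ ≤ C := by
  refine Literature.Analysis.InnerProduct.l2_opNorm_le_of_forall_norm_mulVec_le R hC fun v => ?_
  -- block pieces of v
  set n : β → ℝ := fun b => ‖(toLp 2 (Matrix.diagonal (fun j => if c j = b then (1 : ℂ) else 0) *ᵥ ofLp v) : EuclideanSpace ℂ ι)‖ with hn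
  have hn0 : ∀ b, 0 ≤ n b := fun b => norm_nonneg _
  have hv : ‖v‖ ^ 2 = ∑ b, n b ^ 2 := by
    have := norm_sq_eq_sum_blockProj c (ofLp v)
    rw [toLp_ofLp] at this
    exact this
  -- each output block
  have hout : ∀ b', ‖(toLp 2 (Matrix.diagonal (fun j => if c j = b' then (1 : ℂ) else 0) *ᵥ (R *ᵥ ofLp v)) : EuclideanSpace ℂ ι)‖ ≤ ∑ b, B b' b * n b := by
    intro b'
    conv_lhs => rw [← sum_blockProj_mulVec c (ofLp v), Matrix.mulVec_sum, Matrix.mulVec_sum, WithLp.toLp_sum]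
    refine (norm_sum_le _ _).trans (Finset.sum_le_sum fun b _ => ?_)
    exact (norm_blockProj_mulVec_le c R b' b (ofLp v)).trans (mul_le_mul_of_nonneg_right (hblk b' b) (hn0 b))
  have hsq : ‖(toLp 2 (R *ᵥ ofLp v) : EuclideanSpace ℂ ι)‖ ^ 2 ≤ (C * ‖v‖) ^ 2 := by
    rw [norm_sq_eq_sum_blockProj c (R *ᵥ ofLp v)]
    calc ∑ b', ‖(toLp 2 (Matrix.diagonal (fun j => if c j = b' then (1 : ℂ) else 0) *ᵥ (R *ᵥ ofLp v)) : EuclideanSpace ℂ ι)‖ ^ 2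
        ≤ ∑ b', (∑ b, B b' b * n b) ^ 2 :=
          Finset.sum_le_sum fun b' _ => pow_le_pow_left₀ (norm_nonneg _) (hout b') 2
      _ ≤ ∑ b', (∑ b, B b' b) * ∑ b, B b' b * n b ^ 2 :=
          Finset.sum_le_sum fun b' _ => sq_sum_le_sum_mul_sum (B b') n (hB b')
      _ ≤ ∑ b', C * ∑ b, B b' b * n b ^ 2 :=
          Finset.sum_le_sum fun b' _ => mul_le_mul_of_nonneg_right (hrow b') (Finset.sum_nonneg fun b _ => mul_nonneg (hB b' b) (sq_nonneg _))
      _ = C * ∑ b, (∑ b', B b' b) * n b ^ 2 := by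
          rw [← Finset.mul_sum, Finset.sum_comm]
          congr 1
          refine Finset.sum_congr rfl fun b _ => ?_
          rw [Finset.sum_mul]
      _ ≤ C * ∑ b, C * n b ^ 2 :=
          mul_le_mul_of_nonneg_left (Finset.sum_le_sum fun b _ => mul_le_mul_of_nonneg_right (hcol b) (sq_nonneg _)) hC
      _ = (C * ‖v‖) ^ 2 := by rw [← Finset.mul_sum, ← hv]; ring
  exact (pow_le_pow_iff_left₀ (norm_nonneg _) (by positivity) two_ne_zero).1 hsq

end G3CCT

end Summit.QuantumFields.YangMills.Theorems.BalabanUVNodesPortS1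

end
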